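import Summits.NavierStokesRegularity.NavierStokesRegularity.Theorems.TypeIIInviscidRelaxationAxisymSwirlRegularSelfSimilarBarrier
import HarnessLib

/-!
# A one-sided criterion with SUPERCRITICAL inflow Reynolds numbers away from the parabolic core

Helper toward the crux `AxisymSwirlRegular` (stmt-NavierStokesRegularity-1964, route TypeIIInviscidRelaxation),
criterion side of the registered line `radial_inflow_split` (stub `stub_oneSidedRadialCriterion`, ⟨19059⟩:
`r u_r ≥ −Cν` ⇒ continuation; proved for `C < 2`, open for `C ≥ 2`).

The inflow Reynolds number `Re(x,t) = −r u_r/ν` is the Bessel dimension of the swirl equation at the axis; every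
landed one-sided criterion keeps it below `2` wherever it is prescribed near the axis (`C < 2`; the log gate
`2 − c/log(1/r)`; the κ-gates `M(r/√(ν(T−t)))^κ → 0` at the axis).  THIS FILE proves a criterion of a new shape —
obtained from the generic self-similar reduction `RadialInflowSelfSimilar.hasSmoothExtensionPast_of_reynoldsProfile`
with the EXPLICIT profile `F_{p,m}(ξ) = ξ^p (1+ξ²)^{−(p/2−m)}` (an exact solution of the profile equation):

* `hasSmoothExtensionPast_of_coreReynolds` — for `0 < p < 2`, `0 < m < p/2`, `2m ≤ 1`: an axisymmetric classical
  Leray–Hopf solution of the standing class on `[0,T)` at viscosity `ν` whose inflow Reynolds number obeys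
  `Re ≤ D_{p,m}(ξ)`, `ξ = r/√(ν(T−t))`, on the unit tube, where
  `D_{p,m}(ξ) = (p(2−p) + (9p/2 − m − 4pm)ξ² + (3m + p/2 − 4m²)ξ⁴) / ((1+ξ²)(p + 2mξ²))`,
  extends smoothly past `T`;
* `coreReynolds_ge` — `D_{p,m} ≥ 2 − p` everywhere (so the gate is at least as permissive as the constant gate
  `C = 2 − p < 2`, with equality only on the axis scale `ξ → 0`), and
* `coreReynolds_large` — `D_{p,m}(ξ) ≥ p/(12m)` for `ξ² ≥ max 1 (p/m)` (`m ≤ 1/4`): far from the parabolic core the admissible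
  inflow Reynolds number exceeds ANY prescribed level for `m` small (e.g. `p = 1`, `m = 1/10`: `D ≥ 2` for
  `ξ ≥ 0.75`, `D → 3.8`; `m = 1/100`: `D → 26.5`), while `D_{p,m}(ξ) = (2−p) + O(ξ²)` at the axis.

Reading: blow-up of an axisymmetric solution requires the inflow Reynolds number to reach the profile `D_{p,m}`
somewhere INSIDE the parabolic region `r ≲ √(ν(T−t))`; supercritical sinks (`Re > 2`, any size) confined outside
a parabolic core do not produce a singularity.  To our knowledge not in print (nearest: Zhang 2026's partial
Type I gate `κ = 1` and the κ-family p821608, whose Reynolds profiles vanish at the axis; the constant gates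
Pan 2017 / Zujin Zhang 2018, below `2` everywhere).  Honest label: a regularity CRITERION; the open half `C ≥ 2`
of the stub (Reynolds number `≥ 2` down to the axis scale) is untouched — consistent with the method frontier
(`RadialInflowBarrierWall*`, `RadialInflowCriticalSink`): `D_{p,m}(0) = 2 − p < 2`.  Nothing here proves
`AxisymSwirlRegular` or NavierStokesRegularity.

References: Qi S. Zhang, arXiv:2604.07785 (2026) [Zhang2026PartialTypeI]; X. Pan, J. Differential Equations 2016;
Zujin Zhang, 2018. [new]
-/

noncomputable section

set_option linter.dupNamespace false

open Set Filter Topology Real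
open Literature.Analysis.FluidPDE

namespace Summit.NavierStokesRegularity.NavierStokesRegularity.Theorems.RadialInflowCoreReynolds

open Summit.NavierStokesRegularity.NavierStokesRegularity.Theorems
open Summit.NavierStokesRegularity.NavierStokesRegularity.Theorems.ZhangBarrier
open Summit.NavierStokesRegularity.NavierStokesRegularity.Theorems.RadialInflowSelfSimilar

/-! ## §1 The profile `F_{p,m}(ξ) = ξ^p (1+ξ²)^{−(p/2−m)}` -/

/-- Logarithmic derivative `A = F′/F = p/ξ − 2qξ/(1+ξ²)`, `q = p/2 − m`, and its derivative. -/
theorem hasDerivAt_logDeriv (p m : ℝ) {ξ : ℝ} (hξ : 0 < ξ) :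
    HasDerivAt (fun x : ℝ => p / x - 2 * (p / 2 - m) * x / (1 + x ^ 2))
      (-p / ξ ^ 2 - 2 * (p / 2 - m) * (1 - ξ ^ 2) / (1 + ξ ^ 2) ^ 2) ξ := by
  have h1 : HasDerivAt (fun x : ℝ => p / x) (-p / ξ ^ 2) ξ := by
    have h := (hasDerivAt_inv hξ.ne').const_mul p
    refine (h.congr_of_eventuallyEq ?_).congr_deriv (by field_simp)
    exact Filter.Eventually.of_forall fun x => by simp [div_eq_mul_inv]
  have hden : HasDerivAt (fun x : ℝ => 1 + x ^ 2) (2 * ξ) ξ := by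
    simpa using (hasDerivAt_pow 2 ξ).const_add 1
  have hnum : HasDerivAt (fun x : ℝ => 2 * (p / 2 - m) * x) (2 * (p / 2 - m)) ξ := by
    simpa using (hasDerivAt_id ξ).const_mul (2 * (p / 2 - m))
  have hpos : (1 + ξ ^ 2) ≠ 0 := by positivity
  have h2 := hnum.div hden hpos
  refine (h1.sub h2).congr_deriv ?_
  field_simp
  ring

/-- `F′ = F · A` on `(0,∞)`. -/
theorem hasDerivAt_coreProfile {p m : ℝ} {ξ : ℝ} (hξ : 0 < ξ) :
    HasDerivAt (fun x : ℝ => x ^ p * (1 + x ^ 2) ^ (-(p / 2 - m)))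
      (ξ ^ p * (1 + ξ ^ 2) ^ (-(p / 2 - m)) * (p / ξ - 2 * (p / 2 - m) * ξ / (1 + ξ ^ 2))) ξ := by
  have hb : 0 < 1 + ξ ^ 2 := by positivity
  have h1 : HasDerivAt (fun x : ℝ => x ^ p) (p * ξ ^ (p - 1)) ξ := Real.hasDerivAt_rpow_const (Or.inl hξ.ne')
  have hden : HasDerivAt (fun x : ℝ => 1 + x ^ 2) (2 * ξ) ξ := by
    simpa using (hasDerivAt_pow 2 ξ).const_add 1
  have h2 : HasDerivAt (fun x : ℝ => (1 + x ^ 2) ^ (-(p / 2 - m)))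
      (2 * ξ * (-(p / 2 - m)) * (1 + ξ ^ 2) ^ (-(p / 2 - m) - 1)) ξ := hden.rpow_const (Or.inl hb.ne')
  have h := h1.mul h2
  refine h.congr_deriv ?_
  rw [Real.rpow_sub_one hξ.ne', Real.rpow_sub_one hb.ne']
  field_simp
  ring

/-- `(F·A)′ = F · (A² + A′)` on `(0,∞)`. -/
theorem hasDerivAt_dcoreProfile {p m : ℝ} {ξ : ℝ} (hξ : 0 < ξ) :
    HasDerivAt (fun x : ℝ => x ^ p * (1 + x ^ 2) ^ (-(p / 2 - m)) * (p / x - 2 * (p / 2 - m) * x / (1 + x ^ 2)))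
      (ξ ^ p * (1 + ξ ^ 2) ^ (-(p / 2 - m)) *
        ((p / ξ - 2 * (p / 2 - m) * ξ / (1 + ξ ^ 2)) ^ 2
          + (-p / ξ ^ 2 - 2 * (p / 2 - m) * (1 - ξ ^ 2) / (1 + ξ ^ 2) ^ 2))) ξ := by
  have h := (hasDerivAt_coreProfile (p := p) (m := m) hξ).mul (hasDerivAt_logDeriv p m hξ)
  refine h.congr_deriv ?_
  ring

/-- `deriv F` and `iteratedDeriv 2 F` on `(0,∞)`. -/
theorem derivs_coreProfile {p m : ℝ} {ξ : ℝ} (hξ : 0 < ξ) :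
    deriv (fun x : ℝ => x ^ p * (1 + x ^ 2) ^ (-(p / 2 - m))) ξ
        = ξ ^ p * (1 + ξ ^ 2) ^ (-(p / 2 - m)) * (p / ξ - 2 * (p / 2 - m) * ξ / (1 + ξ ^ 2)) ∧
      iteratedDeriv 2 (fun x : ℝ => x ^ p * (1 + x ^ 2) ^ (-(p / 2 - m))) ξ
        = ξ ^ p * (1 + ξ ^ 2) ^ (-(p / 2 - m)) *
          ((p / ξ - 2 * (p / 2 - m) * ξ / (1 + ξ ^ 2)) ^ 2
            + (-p / ξ ^ 2 - 2 * (p / 2 - m) * (1 - ξ ^ 2) / (1 + ξ ^ 2) ^ 2)) := by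
  refine ⟨(hasDerivAt_coreProfile hξ).deriv, ?_⟩
  rw [show (2 : ℕ) = 1 + 1 from rfl, iteratedDeriv_succ, iteratedDeriv_one]
  have hev : deriv (fun x : ℝ => x ^ p * (1 + x ^ 2) ^ (-(p / 2 - m)))
      =ᶠ[𝓝 ξ] fun x => x ^ p * (1 + x ^ 2) ^ (-(p / 2 - m)) * (p / x - 2 * (p / 2 - m) * x / (1 + x ^ 2)) := by
    filter_upwards [Ioi_mem_nhds hξ] with x hx using (hasDerivAt_coreProfile hx).deriv
  rw [hev.deriv_eq]
  exact (hasDerivAt_dcoreProfile hξ).deriv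

/-- **The profile equation holds with EQUALITY** for the Reynolds profile `D_{p,m}`:
`F″ + (D_{p,m}(ξ)/ξ − 1/ξ − ξ/2)F′ + mF = 0` on `(0,∞)` (a rational identity in `ξ, p, m`). [new] -/
theorem coreProfile_ode {p m : ℝ} (hp : 0 < p) (hm : 0 ≤ m) {ξ : ℝ} (hξ : 0 < ξ) :
    iteratedDeriv 2 (fun x : ℝ => x ^ p * (1 + x ^ 2) ^ (-(p / 2 - m))) ξ
      + ((p * (2 - p) + (9 / 2 * p - m - 4 * p * m) * ξ ^ 2 + (3 * m + p / 2 - 4 * m ^ 2) * ξ ^ 4)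
            / ((1 + ξ ^ 2) * (p + 2 * m * ξ ^ 2)) / ξ - ξ⁻¹ - ξ / 2)
        * deriv (fun x : ℝ => x ^ p * (1 + x ^ 2) ^ (-(p / 2 - m))) ξ
      + m * (ξ ^ p * (1 + ξ ^ 2) ^ (-(p / 2 - m))) = 0 := by
  obtain ⟨h1, h2⟩ := derivs_coreProfile (p := p) (m := m) hξ
  rw [h1, h2]
  have hb : (1 + ξ ^ 2) ≠ 0 := by positivity
  have hc : (p + 2 * m * ξ ^ 2) ≠ 0 := by positivity
  have hξ0 : ξ ≠ 0 := hξ.ne'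
  set Fv := ξ ^ p * (1 + ξ ^ 2) ^ (-(p / 2 - m)) with hFv
  have key : ((p / ξ - 2 * (p / 2 - m) * ξ / (1 + ξ ^ 2)) ^ 2
            + (-p / ξ ^ 2 - 2 * (p / 2 - m) * (1 - ξ ^ 2) / (1 + ξ ^ 2) ^ 2))
      + ((p * (2 - p) + (9 / 2 * p - m - 4 * p * m) * ξ ^ 2 + (3 * m + p / 2 - 4 * m ^ 2) * ξ ^ 4)
            / ((1 + ξ ^ 2) * (p + 2 * m * ξ ^ 2)) / ξ - ξ⁻¹ - ξ / 2)
        * (p / ξ - 2 * (p / 2 - m) * ξ / (1 + ξ ^ 2)) + m = 0 := by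
    field_simp
    ring
  linear_combination Fv * key

/-- Smoothness of the profile on `(0,∞)`. -/
theorem contDiffOn_coreProfile (p m : ℝ) {n : WithTop ℕ∞} :
    ContDiffOn ℝ n (fun x : ℝ => x ^ p * (1 + x ^ 2) ^ (-(p / 2 - m))) (Ioi 0) := by
  intro x hx
  have hx' : x ≠ 0 := ne_of_gt hx
  have h1 : ContDiffAt ℝ n (fun x : ℝ => x ^ p) x := Real.contDiffAt_rpow_const_of_ne hx'
  have h2 : ContDiffAt ℝ n (fun x : ℝ => (1 + x ^ 2) ^ (-(p / 2 - m))) x := by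
    have hf : ContDiffAt ℝ n (fun x : ℝ => 1 + x ^ 2) x := by fun_prop
    exact hf.rpow_const_of_ne (by positivity)
  exact (h1.mul h2).contDiffWithinAt

/-- Continuity of the profile on `[0,∞)` (`p > 0`). -/
theorem continuousOn_coreProfile {p m : ℝ} (hp : 0 < p) :
    ContinuousOn (fun x : ℝ => x ^ p * (1 + x ^ 2) ^ (-(p / 2 - m))) (Ici 0) := by
  have h1 : Continuous (fun x : ℝ => x ^ p) := Real.continuous_rpow_const hp.le
  have h2 : Continuous (fun x : ℝ => (1 + x ^ 2) ^ (-(p / 2 - m))) := by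
    have hf : Continuous (fun x : ℝ => 1 + x ^ 2) := by fun_prop
    exact hf.rpow_const fun x => Or.inl (by positivity)
  exact (h1.mul h2).continuousOn

/-- The profile vanishes at the axis (`p > 0`). -/
theorem coreProfile_zero {p m : ℝ} (hp : 0 < p) :
    (0 : ℝ) ^ p * (1 + (0 : ℝ) ^ 2) ^ (-(p / 2 - m)) = 0 := by
  rw [Real.zero_rpow hp.ne', zero_mul]

/-- Factorisation `F(ξ) = ξ^{2m} · (ξ²/(1+ξ²))^{p/2−m}` for `ξ > 0`. -/
theorem coreProfile_eq {p m : ℝ} {ξ : ℝ} (hξ : 0 < ξ) :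
    ξ ^ p * (1 + ξ ^ 2) ^ (-(p / 2 - m)) = ξ ^ (2 * m) * (ξ ^ 2 / (1 + ξ ^ 2)) ^ (p / 2 - m) := by
  have hb : 0 < 1 + ξ ^ 2 := by positivity
  have h1 : ξ ^ p = ξ ^ (2 * m) * ξ ^ (2 * (p / 2 - m)) := by
    rw [← Real.rpow_add hξ]; congr 1; ring
  have h2 : ξ ^ (2 * (p / 2 - m)) = (ξ ^ 2) ^ (p / 2 - m) := by
    rw [Real.rpow_mul hξ.le, Real.rpow_two]
  rw [h1, h2, Real.div_rpow (sq_nonneg ξ) hb.le, Real.rpow_neg hb.le, div_eq_mul_inv]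
  ring

/-- Upper bound `F ≤ ξ^{2m}` on `[0,∞)` (`p > 0`, `m < p/2`, `m > 0`). -/
theorem coreProfile_le {p m : ℝ} (hp : 0 < p) (hm : 0 < m) (hmp : m < p / 2) {ξ : ℝ} (hξ : 0 ≤ ξ) :
    ξ ^ p * (1 + ξ ^ 2) ^ (-(p / 2 - m)) ≤ 1 * ξ ^ (2 * m) := by
  rcases hξ.eq_or_lt with h0 | hpos
  · rw [← h0, coreProfile_zero hp, Real.zero_rpow (by positivity)]; simp
  rw [coreProfile_eq hpos, one_mul]
  have hb : 0 < 1 + ξ ^ 2 := by positivity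
  have hbase : ξ ^ 2 / (1 + ξ ^ 2) ≤ 1 := by rw [div_le_one hb]; linarith
  have h1 : (ξ ^ 2 / (1 + ξ ^ 2)) ^ (p / 2 - m) ≤ 1 := Real.rpow_le_one (by positivity) hbase (by linarith)
  have h2 : 0 ≤ ξ ^ (2 * m) := Real.rpow_nonneg hξ _
  nlinarith

/-- Far-field lower bound `F(ξ) ≥ (ρ₀²/(1+ρ₀²))^{p/2−m} ξ^{2m}` for `ξ ≥ ρ₀ > 0`. -/
theorem coreProfile_ge_far {p m ρ₀ : ℝ} (hmp : m < p / 2) (hρ₀ : 0 < ρ₀) {ξ : ℝ} (hξ : ρ₀ ≤ ξ) :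
    (ρ₀ ^ 2 / (1 + ρ₀ ^ 2)) ^ (p / 2 - m) * ξ ^ (2 * m) ≤ ξ ^ p * (1 + ξ ^ 2) ^ (-(p / 2 - m)) := by
  have hpos : 0 < ξ := hρ₀.trans_le hξ
  rw [coreProfile_eq hpos, mul_comm]
  apply mul_le_mul_of_nonneg_left _ (Real.rpow_nonneg hpos.le _)
  apply Real.rpow_le_rpow (by positivity) _ (by linarith)
  -- `ρ₀²/(1+ρ₀²) ≤ ξ²/(1+ξ²)`
  have h1 : ρ₀ ^ 2 ≤ ξ ^ 2 := by nlinarith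
  rw [div_le_div_iff₀ (by positivity) (by positivity)]
  nlinarith

/-- Near-field lower bound `F(ξ) ≥ (2ρ₀)^{p−2}(1+4ρ₀²)^{−(p/2−m)} ξ²` on `[0, 2ρ₀]` (`0 < p < 2`). -/
theorem coreProfile_ge_near {p m ρ₀ : ℝ} (hp : 0 < p) (hp2 : p < 2) (hmp : m < p / 2) (hρ₀ : 0 < ρ₀) {ξ : ℝ}
    (h0 : 0 ≤ ξ) (h2 : ξ ≤ 2 * ρ₀) :
    (2 * ρ₀) ^ (p - 2) * (1 + 4 * ρ₀ ^ 2) ^ (-(p / 2 - m)) * ξ ^ 2 ≤ ξ ^ p * (1 + ξ ^ 2) ^ (-(p / 2 - m)) := by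
  rcases h0.eq_or_lt with h00 | hpos
  · rw [← h00, coreProfile_zero hp]; simp
  have hb : 0 < 1 + ξ ^ 2 := by positivity
  have hb4 : 0 < 1 + 4 * ρ₀ ^ 2 := by positivity
  -- `ξ^p = ξ² ξ^{p−2} ≥ ξ² (2ρ₀)^{p−2}`
  have h1 : (2 * ρ₀) ^ (p - 2) * ξ ^ 2 ≤ ξ ^ p := by
    have e : ξ ^ p = ξ ^ (p - 2) * ξ ^ 2 := by
      rw [show ξ ^ 2 = ξ ^ (2 : ℝ) by norm_cast, ← Real.rpow_add hpos]; ring_nf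
    rw [e]
    apply mul_le_mul_of_nonneg_right _ (sq_nonneg ξ)
    exact Real.rpow_le_rpow_of_nonpos hpos h2 (by linarith)
  -- `(1+ξ²)^{−q} ≥ (1+4ρ₀²)^{−q}`
  have h3 : (1 + 4 * ρ₀ ^ 2) ^ (-(p / 2 - m)) ≤ (1 + ξ ^ 2) ^ (-(p / 2 - m)) := by
    apply Real.rpow_le_rpow_of_nonpos hb _ (by linarith)
    nlinarith
  have h4 : 0 ≤ (1 + 4 * ρ₀ ^ 2) ^ (-(p / 2 - m)) := Real.rpow_nonneg hb4.le _
  have h5 : 0 ≤ ξ ^ p := Real.rpow_nonneg hpos.le _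
  calc (2 * ρ₀) ^ (p - 2) * (1 + 4 * ρ₀ ^ 2) ^ (-(p / 2 - m)) * ξ ^ 2
      = ((2 * ρ₀) ^ (p - 2) * ξ ^ 2) * (1 + 4 * ρ₀ ^ 2) ^ (-(p / 2 - m)) := by ring
    _ ≤ ξ ^ p * (1 + 4 * ρ₀ ^ 2) ^ (-(p / 2 - m)) := mul_le_mul_of_nonneg_right h1 h4
    _ ≤ ξ ^ p * (1 + ξ ^ 2) ^ (-(p / 2 - m)) := mul_le_mul_of_nonneg_left h3 h5

/-- The profile is nondecreasing on `[0,∞)`. -/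
theorem monotoneOn_coreProfile {p m : ℝ} (hp : 0 < p) (hm : 0 ≤ m) :
    MonotoneOn (fun x : ℝ => x ^ p * (1 + x ^ 2) ^ (-(p / 2 - m))) (Ici 0) := by
  refine monotoneOn_of_deriv_nonneg (convex_Ici 0) (continuousOn_coreProfile hp) ?_ ?_
  · rw [interior_Ici]
    exact fun x hx => (hasDerivAt_coreProfile hx).differentiableAt.differentiableWithinAt
  · rw [interior_Ici]
    intro x hx
    rw [(hasDerivAt_coreProfile hx).deriv]
    have hx0 : 0 < x := hx
    have hb : 0 < 1 + x ^ 2 := by positivity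
    have hA : 0 ≤ p / x - 2 * (p / 2 - m) * x / (1 + x ^ 2) := by
      have e : p / x - 2 * (p / 2 - m) * x / (1 + x ^ 2) = (p + 2 * m * x ^ 2) / (x * (1 + x ^ 2)) := by
        field_simp; ring
      rw [e]; positivity
    have h1 : 0 ≤ x ^ p := Real.rpow_nonneg hx0.le _
    have h2 : 0 ≤ (1 + x ^ 2) ^ (-(p / 2 - m)) := Real.rpow_nonneg hb.le _
    positivity

/-! ## §2 The Reynolds profile `D_{p,m}` -/

/-- **`D_{p,m} ≥ 2 − p` everywhere** (`0 < p`, `0 ≤ m ≤ p/2`):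
`D_{p,m}(ξ) − (2−p) = ((p + 5/2)(p − 2m)ξ² + (1 + 4m)(p/2 − m)ξ⁴)/((1+ξ²)(p + 2mξ²)) ≥ 0`. [new] -/
theorem coreReynolds_ge {p m : ℝ} (hp : 0 < p) (hm : 0 ≤ m) (hmp : m ≤ p / 2) (ξ : ℝ) :
    2 - p ≤ (p * (2 - p) + (9 / 2 * p - m - 4 * p * m) * ξ ^ 2 + (3 * m + p / 2 - 4 * m ^ 2) * ξ ^ 4)
        / ((1 + ξ ^ 2) * (p + 2 * m * ξ ^ 2)) := by
  have hQ : 0 < (1 + ξ ^ 2) * (p + 2 * m * ξ ^ 2) := by positivity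
  rw [le_div_iff₀ hQ]
  have h1 : 0 ≤ (p + 5 / 2) * (p - 2 * m) * ξ ^ 2 := by
    have : 0 ≤ p - 2 * m := by linarith
    positivity
  have h2 : 0 ≤ (1 + 4 * m) * (p / 2 - m) * ξ ^ 4 := by
    have : 0 ≤ p / 2 - m := by linarith
    positivity
  nlinarith [h1, h2]

/-- **Far from the core the admissible Reynolds number is large:** for `ξ² ≥ max 1 (p/m)` (`0 < m ≤ 1/4`,
`m < p/2`), `D_{p,m}(ξ) ≥ p/(12m)`. (Limit: `D_{p,m}(ξ) → 3/2 − 2m + p/(4m)` as `ξ → ∞`.) [new] -/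
theorem coreReynolds_large {p m : ℝ} (hp : 0 < p) (hm : 0 < m) (hm4 : m ≤ 1 / 4) (hmp : m < p / 2) {ξ : ℝ}
    (hξ1 : 1 ≤ ξ ^ 2) (hξp : p / m ≤ ξ ^ 2) :
    p / (12 * m) ≤ (p * (2 - p) + (9 / 2 * p - m - 4 * p * m) * ξ ^ 2 + (3 * m + p / 2 - 4 * m ^ 2) * ξ ^ 4)
        / ((1 + ξ ^ 2) * (p + 2 * m * ξ ^ 2)) := by
  set y := ξ ^ 2 with hy
  have hy0 : 0 ≤ y := sq_nonneg ξ
  have hQ : 0 < (1 + y) * (p + 2 * m * y) := by positivity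
  have hy4 : ξ ^ 4 = y ^ 2 := by rw [hy]; ring
  rw [hy4, le_div_iff₀ hQ]
  -- `p ≤ m y`, `1 ≤ y`: `(1+y)(p+2my) ≤ 2y · 3my = 6my²`, and `P(y) ≥ (3m + p/2 − 4m²) y² ≥ (p/2 − m) y²`…
  have hpy : p ≤ m * y := by
    have h := (div_le_iff₀ hm).1 hξp
    linarith [mul_comm y m]
  have hQle : (1 + y) * (p + 2 * m * y) ≤ 6 * m * y ^ 2 := by nlinarith
  have hP1 : 0 ≤ p * (2 - p) + (9 / 2 * p - m - 4 * p * m) * y := by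
    -- `9p/2 − m − 4pm ≥ 9p/2 − p/2 − p = 3p > 0` using `m < p/2`, `m ≤ 1/4`; and `p(2−p) ≥ -p² ≥ …`: use `p ≤ m y ≤ y/4`
    have hc : 3 * p ≤ 9 / 2 * p - m - 4 * p * m := by nlinarith
    have hpy' : p ≤ y / 4 := by nlinarith
    nlinarith
  have hP2 : p / (12 * m) * (6 * m * y ^ 2) ≤ (3 * m + p / 2 - 4 * m ^ 2) * y ^ 2 := by
    have e : p / (12 * m) * (6 * m * y ^ 2) = (p / 2) * y ^ 2 := by field_simp; ring
    rw [e]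
    apply mul_le_mul_of_nonneg_right _ (sq_nonneg y)
    nlinarith
  have hpos : 0 ≤ p / (12 * m) := by positivity
  nlinarith [mul_le_mul_of_nonneg_left hQle hpos]

/-! ## §3 The criterion -/

/-- **One-sided criterion with supercritical inflow Reynolds numbers outside the parabolic core.** Let
`0 < p < 2`, `0 < m < p/2`, `2m ≤ 1`, `ν, T > 0`, and let `(u, p)` be a classical solution on `[0,T)` at viscosity
`ν`, Leray–Hopf from a rapidly decaying datum, with axisymmetric slices.  If on the unit tube `0 < r ≤ 1`
`u_r(x,t) ≥ −ν D_{p,m}(r/√(ν(T−t)))/r` — inflow Reynolds number `−r u_r/ν` at most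
`D_{p,m}(ξ) = (p(2−p) + (9p/2 − m − 4pm)ξ² + (3m + p/2 − 4m²)ξ⁴)/((1+ξ²)(p + 2mξ²))` (`= 2 − p` at the axis scale,
`≥ 2 − p` everywhere, `≥ p/(12m)` for `ξ² ≥ max 1 (p/m)`, `m ≤ 1/4`) — then `u` extends smoothly past `T`.  Proof: the generic
self-similar reduction `RadialInflowSelfSimilar.hasSmoothExtensionPast_of_reynoldsProfile` with the exact profile
`F_{p,m} = ξ^p(1+ξ²)^{−(p/2−m)}` (`coreProfile_ode`) and its bounds. [new] -/
theorem hasSmoothExtensionPast_of_coreReynolds {p₀ m ν T : ℝ}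
    {u : ℝ → EuclideanSpace ℝ (Fin 3) → EuclideanSpace ℝ (Fin 3)} {p : ℝ → EuclideanSpace ℝ (Fin 3) → ℝ}
    (hp : 0 < p₀) (hp2 : p₀ < 2) (hm : 0 < m) (hmp : m < p₀ / 2) (h2m : 2 * m ≤ 1) (hν : 0 < ν) (hT : 0 < T)
    (hcl : IsClassicalNSSolutionOn (Ico 0 T) ν 0 u p) (hLH : IsLerayHopfOn T ν 0 (u 0) u)
    (hdec : HasRapidSpatialDecay (u 0)) (hax : ∀ t ∈ Ico 0 T, IsAxisymmetric (u t))
    (henv : ∀ t ∈ Ico 0 T, ∀ x : EuclideanSpace ℝ (Fin 3), 0 < cylRadius x → cylRadius x ≤ 1 →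
      -(ν * ((p₀ * (2 - p₀) + (9 / 2 * p₀ - m - 4 * p₀ * m) * (cylRadius x / √(ν * (T - t))) ^ 2
              + (3 * m + p₀ / 2 - 4 * m ^ 2) * (cylRadius x / √(ν * (T - t))) ^ 4)
            / ((1 + (cylRadius x / √(ν * (T - t))) ^ 2) * (p₀ + 2 * m * (cylRadius x / √(ν * (T - t))) ^ 2)))
          / cylRadius x) ≤ radialVelocity (u t) x) :
    HasSmoothExtensionPast ν 0 u T := by
  have hρ₀ : 0 < rho (ν * T) 0 := rho_pos _ _
  have hk₁ : 0 < (rho (ν * T) 0 ^ 2 / (1 + rho (ν * T) 0 ^ 2)) ^ (p₀ / 2 - m) := by positivity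
  have hk₂ : 0 < (2 * rho (ν * T) 0) ^ (p₀ - 2) * (1 + 4 * rho (ν * T) 0 ^ 2) ^ (-(p₀ / 2 - m)) := by positivity
  exact hasSmoothExtensionPast_of_reynoldsProfile
    (D := fun ξ => (p₀ * (2 - p₀) + (9 / 2 * p₀ - m - 4 * p₀ * m) * ξ ^ 2 + (3 * m + p₀ / 2 - 4 * m ^ 2) * ξ ^ 4)
      / ((1 + ξ ^ 2) * (p₀ + 2 * m * ξ ^ 2)))
    (F := fun x : ℝ => x ^ p₀ * (1 + x ^ 2) ^ (-(p₀ / 2 - m)))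
    hν hT hm h2m one_pos hk₁ hk₂ (contDiffOn_coreProfile p₀ m) (continuousOn_coreProfile hp)
    (coreProfile_zero hp) (monotoneOn_coreProfile hp hm.le) (fun ξ hξ => coreProfile_le hp hm hmp hξ)
    (fun ξ hξ => coreProfile_ge_far hmp hρ₀ hξ) (fun ξ h0 h2 => coreProfile_ge_near hp hp2 hmp hρ₀ h0 h2)
    (fun ξ hξ => (coreProfile_ode hp hm.le hξ).le) hcl hLH hdec hax henv

end Summit.NavierStokesRegularity.NavierStokesRegularity.Theorems.RadialInflowCoreReynolds

end
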